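import Summits.NavierStokesRegularity.FluidComputer.PalasekTowerGermHostExplicit

/-!
# The germ host, XXVI: the two `LineGermData` inequalities from NUMERIC sup bounds — the certificate's
# obligations for `line` (width `σ₀`) and `window` (fade `ε`)

Cell `ns-blowup`, seat `ns-blowup-ecbridge-3` (g5); GROUP C «BRIDGE SUPPORT» of the route
`PalasekTowerBreakdown` (crux `EpisodeBaseG`, item stmt-NavierStokesRegularity-19179, R2; registered line
`slot` v5: `stub_explicit_slice_run : ∃ U ρ σ₀ ε c₄ (_ : Germ.LineGermData U ρ σ₀ ε c₄) v q, …`). Sequel of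
`PalasekTowerGermHostExplicit.lean` (g3: the slot `LineGermData`; `LevelZeroData.lineGermData` fills it at the
`Classical.choose` values `h.width`, `h.fadeLen`). LABEL: E–C typing (KERNEL, proofs only). WHAT THIS IS NOT:
not Navier–Stokes evidence — algebra and one-variable calculus turning the two global inequalities of the
certificate slot into a finite list of sup-norm numbers; nothing about any flow after `τ₀`, `FirstEpisodeD`,
`RungG 1` or blow-up. No number is supplied here for any design (refuter4 K97 (2)(ii)(iii): for the strict tiny
profile they need `C³`/`C⁴` sup norms of `Real.smoothTransition`-built fields and of the nonlocal `accel`).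

## What (DIRECTOR-NS g6 #3 (4): «the two explicit `LineGermData` inequalities `line` / `window`»)

* §1 `line` — TWO quantitative forms of g3's compactness lemma `exists_line_anchor`:
  `line_anchor_of_endpoint` (convexity of `σ ↦ ‖U + σV‖²`: the ceiling, the STRICT test on the argmax and
  the ONE endpoint inequality `‖U − σ₀V‖ ≤ Y` everywhere give `‖U + σV‖ < Y` for all `σ ∈ (−σ₀, 0)`), and
  `line_anchor_of_bounds` (a sup bound `‖V‖ ≤ M`, a cap `{‖U‖ ≥ Y − δ}` on which `⟪U, V⟫ ≥ κ > 0`, and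
  `σ₀ M² < 2κ`, `σ₀ M ≤ δ`);
* §2 the residual of the line germ on `t ≥ 1/2` in CLOSED FORM with three `t`-independent fields:
  `germResid t = (e^{(t−1)/σ₀} − 1) • W + σline σ₀ t • E + (σline σ₀ t)² • F`, `W = ΔU − (U·∇)U` (the drift),
  `E = DU·V + DV·U − ΔV`, `F = (V·∇)V − ∇(|∇π|²/2)` (`germResid_line_eq`);
* §3 `window` from three sup bounds `‖W‖ ≤ w`, `‖E‖ ≤ e`, `‖F‖ ≤ f` and the scalar inequality
  `q w + σ₀ q e + (σ₀ q)² f ≤ c₄Y₀`, `q = e^{ε/σ₀} − 1` (`window_of_field_bounds`);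
* §4 the constructor `LevelZeroData.lineGermData_of_bounds`: a strict-slot filler plus the numbers
  `(σ₀, ε, c₄)` and the four sup inequalities IS a `LineGermData U ρ σ₀ ε c₄` — exactly what a certified grid
  evaluation has to deliver for a named design, with no `Classical.choose` left.

References: A. J. Majda, A. L. Bertozzi, *Vorticity and Incompressible Flow* (CUP 2002), §1.8 Prop. 1.16
[cite: MajdaBertozziCUP2002, §1.8 Prop. 1.16]; S. Palasek, arXiv:2605.13827 §3.3 [cite: Palasek2026ElementaryModel, §3.3];
C. L. Fefferman, Clay problem description, (1) [cite: FeffermanClay2006, (1)].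
-/

noncomputable section

namespace Summit.NavierStokesRegularity.FluidComputer.PalasekTowerClayBridge.Germ

open Set Function Filter Topology InnerProductSpace Metric MeasureTheory
open scoped Topology ContDiff RealInnerProductSpace Laplacian

open Literature.Analysis.FluidPDE

/-! ## §1 The line anchor from numeric data -/

section Line

variable {U V : EuclideanSpace ℝ (Fin 3) → EuclideanSpace ℝ (Fin 3)} {Y σ₀ : ℝ}

/-- **LINE ANCHOR, ENDPOINT FORM.** If `‖U‖ ≤ Y` everywhere, `⟪U(x), V(x)⟫ > 0` wherever `‖U(x)‖ = Y`, and the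
single endpoint inequality `‖U(x) − σ₀ V(x)‖ ≤ Y` holds everywhere (`σ₀ > 0`), then `‖U(x) + σ V(x)‖ < Y` for every
`σ ∈ (−σ₀, 0)` and every `x` — `σ ↦ ‖U(x) + σV(x)‖²` is a convex parabola, so it stays below the larger endpoint,
strictly unless it touches `Y²` at `σ = 0` with positive slope. [cite: MajdaBertozziCUP2002, §1.8 Prop. 1.16] -/
theorem line_anchor_of_endpoint (hle : ∀ x, ‖U x‖ ≤ Y) (htest : ∀ x, ‖U x‖ = Y → 0 < ⟪U x, V x⟫)
    (hσ₀ : 0 < σ₀) (hend : ∀ x, ‖U x - σ₀ • V x‖ ≤ Y) {σ : ℝ} (hσl : -σ₀ < σ) (hσu : σ < 0)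
    (x : EuclideanSpace ℝ (Fin 3)) : ‖U x + σ • V x‖ < Y := by
  have hY : 0 ≤ Y := (norm_nonneg _).trans (hle x)
  have hq : ‖U x + σ • V x‖ ^ 2 = ‖U x‖ ^ 2 + 2 * σ * ⟪U x, V x⟫ + σ ^ 2 * ‖V x‖ ^ 2 :=
    norm_add_smul_sq _ _ _
  have hqe : ‖U x - σ₀ • V x‖ ^ 2 = ‖U x‖ ^ 2 + 2 * (-σ₀) * ⟪U x, V x⟫ + (-σ₀) ^ 2 * ‖V x‖ ^ 2 := by
    rw [← norm_add_smul_sq, neg_smul, sub_eq_add_neg]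
  have hend2 : ‖U x - σ₀ • V x‖ ^ 2 ≤ Y ^ 2 := pow_le_pow_left₀ (norm_nonneg _) (hend x) 2
  have hle2 : ‖U x‖ ^ 2 ≤ Y ^ 2 := pow_le_pow_left₀ (norm_nonneg _) (hle x) 2
  -- the endpoint inequality in expanded form: `σ₀ ‖V‖² ≤ 2⟪U,V⟫ + (Y² − ‖U‖²)/σ₀`
  have hE : -2 * σ₀ * ⟪U x, V x⟫ + σ₀ ^ 2 * ‖V x‖ ^ 2 ≤ Y ^ 2 - ‖U x‖ ^ 2 := by
    rw [hqe] at hend2; nlinarith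
  suffices hsq : ‖U x + σ • V x‖ ^ 2 < Y ^ 2 by
    exact lt_of_pow_lt_pow_left₀ 2 hY hsq
  rw [hq]
  -- convex combination: with `λ = −σ/σ₀ ∈ (0, 1)`,
  -- `2σ⟪U,V⟫ + σ²‖V‖² ≤ λ(−2σ₀⟪U,V⟫ + σ₀²‖V‖²)` because `σ² ≤ λ σ₀² = −σ σ₀`
  have hlam : σ ^ 2 * ‖V x‖ ^ 2 ≤ -σ * σ₀ * ‖V x‖ ^ 2 := by
    apply mul_le_mul_of_nonneg_right _ (sq_nonneg _)
    nlinarith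
  by_cases hmax : ‖U x‖ = Y
  · -- at the argmax: the endpoint inequality reads `σ₀ ‖V‖² ≤ 2⟪U, V⟫`, and the slope at `0` is positive
    have hpos := htest x hmax
    have hE' : σ₀ * ‖V x‖ ^ 2 ≤ 2 * ⟪U x, V x⟫ := by
      rw [hmax] at hE
      nlinarith
    rw [hmax]
    by_cases hV : ‖V x‖ = 0
    · rw [hV]
      nlinarith [mul_neg_of_neg_of_pos hσu hpos]
    · have hVpos : 0 < ‖V x‖ ^ 2 := by positivity
      have hσσ : σ ^ 2 < -σ * σ₀ := by nlinarith [mul_neg_of_neg_of_pos hσu (show 0 < σ + σ₀ by linarith)]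
      have hlam' : σ ^ 2 * ‖V x‖ ^ 2 < -σ * σ₀ * ‖V x‖ ^ 2 := mul_lt_mul_of_pos_right hσσ hVpos
      have h1 : -σ * σ₀ * ‖V x‖ ^ 2 ≤ -σ * (2 * ⟪U x, V x⟫) := by
        have := mul_le_mul_of_nonneg_left hE' (show 0 ≤ -σ by linarith)
        linarith [this]
      nlinarith [hlam', h1]
  · -- away from the argmax: `‖U x‖ < Y`, convex combination of `< Y²` and `≤ Y²`
    have hlt : ‖U x‖ < Y := lt_of_le_of_ne (hle x) hmax
    have hlt2 : ‖U x‖ ^ 2 < Y ^ 2 := by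
      exact pow_lt_pow_left₀ hlt (norm_nonneg _) two_ne_zero
    -- `2σa + σ²‖V‖² ≤ (−σ/σ₀)(−2σ₀ a + σ₀²‖V‖²) ≤ (−σ/σ₀)(Y² − ‖U‖²)`
    have h3 : 2 * σ * ⟪U x, V x⟫ + σ ^ 2 * ‖V x‖ ^ 2 ≤
        -σ / σ₀ * (-2 * σ₀ * ⟪U x, V x⟫ + σ₀ ^ 2 * ‖V x‖ ^ 2) := by
      have e1 : -σ / σ₀ * (-2 * σ₀ * ⟪U x, V x⟫ + σ₀ ^ 2 * ‖V x‖ ^ 2) =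
          2 * σ * ⟪U x, V x⟫ + -σ * σ₀ * ‖V x‖ ^ 2 := by
        field_simp
        ring
      rw [e1]
      linarith [hlam]
    have h4 : -σ / σ₀ * (-2 * σ₀ * ⟪U x, V x⟫ + σ₀ ^ 2 * ‖V x‖ ^ 2) ≤ -σ / σ₀ * (Y ^ 2 - ‖U x‖ ^ 2) :=
      mul_le_mul_of_nonneg_left hE (div_pos (by linarith) hσ₀).le
    have h5 : -σ / σ₀ * (Y ^ 2 - ‖U x‖ ^ 2) < Y ^ 2 - ‖U x‖ ^ 2 := by
      have hl : -σ / σ₀ < 1 := by rw [div_lt_one hσ₀]; linarith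
      have hp : 0 < Y ^ 2 - ‖U x‖ ^ 2 := by linarith
      calc -σ / σ₀ * (Y ^ 2 - ‖U x‖ ^ 2) < 1 * (Y ^ 2 - ‖U x‖ ^ 2) := mul_lt_mul_of_pos_right hl hp
        _ = Y ^ 2 - ‖U x‖ ^ 2 := one_mul _
    linarith

/-- **LINE ANCHOR, SUP-BOUND FORM** (the quantitative content of g3's `exists_line_anchor`): if `‖U‖ ≤ Y`,
`‖V‖ ≤ M` everywhere, `⟪U(x), V(x)⟫ ≥ κ` on the cap `{‖U(x)‖ ≥ Y − δ}`, and the width satisfies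
`σ₀ M² < 2κ` and `σ₀ M ≤ δ`, then `‖U(x) + σV(x)‖ < Y` for all `σ ∈ (−σ₀, 0)` and all `x`.
[cite: MajdaBertozziCUP2002, §1.8 Prop. 1.16] -/
theorem line_anchor_of_bounds {M δ κ : ℝ} (hle : ∀ x, ‖U x‖ ≤ Y) (hM : ∀ x, ‖V x‖ ≤ M)
    (hcap : ∀ x, Y - δ ≤ ‖U x‖ → κ ≤ ⟪U x, V x⟫) (hσ₁ : σ₀ * M ^ 2 < 2 * κ) (hσ₂ : σ₀ * M ≤ δ)
    {σ : ℝ} (hσl : -σ₀ < σ) (hσu : σ < 0) (x : EuclideanSpace ℝ (Fin 3)) : ‖U x + σ • V x‖ < Y := by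
  have hM0 : 0 ≤ M := (norm_nonneg _).trans (hM x)
  by_cases hnear : Y - δ ≤ ‖U x‖
  · -- on the cap: `‖U + σV‖² ≤ Y² + σ(2κ + σM²) < Y²`
    have hY : 0 ≤ Y := (norm_nonneg _).trans (hle x)
    have hk := hcap x hnear
    have hsq : ‖U x + σ • V x‖ ^ 2 < Y ^ 2 := by
      rw [norm_add_smul_sq]
      have h1 : ‖U x‖ ^ 2 ≤ Y ^ 2 := pow_le_pow_left₀ (norm_nonneg _) (hle x) 2
      have h2 : 2 * σ * ⟪U x, V x⟫ ≤ 2 * σ * κ := by nlinarith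
      have h3 : σ ^ 2 * ‖V x‖ ^ 2 ≤ σ ^ 2 * M ^ 2 :=
        mul_le_mul_of_nonneg_left (pow_le_pow_left₀ (norm_nonneg _) (hM x) 2) (sq_nonneg _)
      -- `2κ + σ M² > 2κ − σ₀ M² > 0`
      have h4 : 0 < 2 * κ + σ * M ^ 2 := by nlinarith [sq_nonneg M]
      have h5 : 2 * σ * κ + σ ^ 2 * M ^ 2 < 0 := by
        have : 2 * σ * κ + σ ^ 2 * M ^ 2 = σ * (2 * κ + σ * M ^ 2) := by ring
        rw [this]; exact mul_neg_of_neg_of_pos hσu h4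
      linarith
    exact lt_of_pow_lt_pow_left₀ 2 hY hsq
  · -- off the cap: `‖U + σV‖ ≤ ‖U‖ + |σ| M < Y − δ + σ₀ M ≤ Y`
    push Not at hnear
    calc ‖U x + σ • V x‖ ≤ ‖U x‖ + ‖σ • V x‖ := norm_add_le _ _
      _ = ‖U x‖ + (-σ) * ‖V x‖ := by rw [norm_smul, Real.norm_eq_abs, abs_of_neg hσu]
      _ ≤ ‖U x‖ + σ₀ * M := by
          gcongr
          · linarith
          · linarith
          · exact hM x
      _ < Y := by linarith

end Line

/-! ## §2 The residual of the line germ after `t = 1/2`, in closed form -/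

section Resid

variable {U : EuclideanSpace ℝ (Fin 3) → EuclideanSpace ℝ (Fin 3)} {σ₀ : ℝ}

/-- `αhost' = 0` after `t = 1/2` (`αhost ≡ 1` there). [folklore] -/
theorem deriv_αhost_of_half_lt {t : ℝ} (ht : 1 / 2 < t) : deriv αhost t = 0 := by
  have hev : αhost =ᶠ[𝓝 t] fun _ => (1 : ℝ) := by
    filter_upwards [lt_mem_nhds ht] with s hs
    exact αhost_of_half_le hs.le
  rw [hev.deriv_eq, deriv_const]

/-- `βhost σ₀ = σline σ₀` after `t = 1/2`. [folklore] -/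
theorem βhost_of_half_le {t : ℝ} (ht : 1 / 2 ≤ t) : βhost σ₀ t = σline σ₀ t := by
  rw [βhost, αhost_of_half_le ht, one_mul]

/-- `βhost' = exp((t − 1)/σ₀)` after `t = 1/2` (`σ₀ ≠ 0`). [folklore] -/
theorem deriv_βhost_of_half_lt (hσ₀ : σ₀ ≠ 0) {t : ℝ} (ht : 1 / 2 < t) :
    deriv (βhost σ₀) t = Real.exp ((t - 1) / σ₀) := by
  have hev : βhost σ₀ =ᶠ[𝓝 t] σline σ₀ := by
    filter_upwards [lt_mem_nhds ht] with s hs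
    exact βhost_of_half_le hs.le
  rw [hev.deriv_eq, (hasDerivAt_σline hσ₀ t).deriv]

/-- **THE RESIDUAL OF THE LINE GERM AFTER `t = 1/2`, IN CLOSED FORM** (unit viscosity): with the drift
`W = ΔU − (U·∇)U`, the acceleration `V = P W` and the pressure potential `π`,
`germResid t = (e^{(t−1)/σ₀} − 1) • W + σline σ₀ t • (DU·V + DV·U − ΔV) + (σline σ₀ t)² • ((V·∇)V − ∇(|∇π|²/2))`
— three `t`-INDEPENDENT fields with explicit scalar coefficients vanishing at `t = 1`. [cite: FeffermanClay2006, (1)] -/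
theorem germResid_line_eq (hU : ContDiff ℝ ∞ U) (hUc : HasCompactSupport U) (hσ₀ : σ₀ ≠ 0) {t : ℝ}
    (ht : 1 / 2 < t) (x : EuclideanSpace ℝ (Fin 3)) :
    germResid 1 U αhost (βhost σ₀) t x =
      (Real.exp ((t - 1) / σ₀) - 1) • drift 1 U x +
        σline σ₀ t • (fderiv ℝ U x (accel 1 U x) + fderiv ℝ (accel 1 U) x (U x) - (Δ (accel 1 U)) x) +
        σline σ₀ t ^ 2 • (convect (accel 1 U) (accel 1 U) x -
          gradient (fun y => 2⁻¹ * ‖gradient (pot 1 U) y‖ ^ 2) x) := by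
  rw [germResid_eq hU hUc, αhost_of_half_le ht.le, deriv_αhost_of_half_lt ht, βhost_of_half_le ht.le,
    deriv_βhost_of_half_lt hσ₀ ht]
  have hd : drift 1 U x = accel 1 U x + gradient (pot 1 U) x := by
    rw [accel_apply, sub_add_cancel]
  have hd' : convect U U x = (1 : ℝ) • (Δ U) x - drift 1 U x := by
    simp only [drift, sub_sub_cancel]
  rw [hd', hd]
  set A := (Δ U) x
  set V := accel 1 U x
  set P := gradient (pot 1 U) x
  set E₁ := fderiv ℝ U x V + fderiv ℝ (accel 1 U) x (U x)
  set L := (Δ (accel 1 U)) x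
  set C := convect (accel 1 U) (accel 1 U) x
  set G := gradient (fun y => 2⁻¹ * ‖gradient (pot 1 U) y‖ ^ 2) x
  set e := Real.exp ((t - 1) / σ₀)
  set s := σline σ₀ t
  module

end Resid

/-! ## §3 The residual bound on the fade window from three sup norms -/

section Window

variable {U : EuclideanSpace ℝ (Fin 3) → EuclideanSpace ℝ (Fin 3)} {σ₀ ε : ℝ}

/-- On `[1, 1 + ε]`: `0 ≤ e^{(t−1)/σ₀} − 1 ≤ e^{ε/σ₀} − 1` (`σ₀ > 0`). [folklore] -/
theorem exp_sub_one_mem {t : ℝ} (hσ₀ : 0 < σ₀) (ht : t ∈ Icc (1 : ℝ) (1 + ε)) :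
    0 ≤ Real.exp ((t - 1) / σ₀) - 1 ∧ Real.exp ((t - 1) / σ₀) - 1 ≤ Real.exp (ε / σ₀) - 1 := by
  constructor
  · have : 0 ≤ (t - 1) / σ₀ := div_nonneg (by linarith [ht.1]) hσ₀.le
    linarith [Real.one_le_exp this]
  · have : (t - 1) / σ₀ ≤ ε / σ₀ := div_le_div_of_nonneg_right (by linarith [ht.2]) hσ₀.le
    linarith [Real.exp_le_exp.2 this]

/-- On `[1, 1 + ε]`: `0 ≤ σline σ₀ t ≤ σ₀ (e^{ε/σ₀} − 1)` (`σ₀ > 0`). [folklore] -/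
theorem σline_mem {t : ℝ} (hσ₀ : 0 < σ₀) (ht : t ∈ Icc (1 : ℝ) (1 + ε)) :
    0 ≤ σline σ₀ t ∧ σline σ₀ t ≤ σ₀ * (Real.exp (ε / σ₀) - 1) := by
  obtain ⟨h1, h2⟩ := exp_sub_one_mem hσ₀ ht
  rw [σline]
  exact ⟨mul_nonneg hσ₀.le h1, mul_le_mul_of_nonneg_left h2 hσ₀.le⟩

/-- **THE WINDOW BOUND FROM THREE SUP NORMS.** If `‖W‖ ≤ w`, `‖DU·V + DV·U − ΔV‖ ≤ e` and
`‖(V·∇)V − ∇(|∇π|²/2)‖ ≤ f` everywhere, `σ₀ > 0`, and with `q := e^{ε/σ₀} − 1` the scalar inequality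
`q w + σ₀ q e + (σ₀ q)² f ≤ c₄ Y₀` holds, then `‖germResid t x‖ ≤ c₄ Y₀` for all `t ∈ [1, 1 + ε]` and all `x`.
[cite: FeffermanClay2006, (1)] -/
theorem window_of_field_bounds (hU : ContDiff ℝ ∞ U) (hUc : HasCompactSupport U) (hσ₀ : 0 < σ₀)
    {w e f c₄ : ℝ} (hw : ∀ x, ‖drift 1 U x‖ ≤ w)
    (he : ∀ x, ‖fderiv ℝ U x (accel 1 U x) + fderiv ℝ (accel 1 U) x (U x) - (Δ (accel 1 U)) x‖ ≤ e)
    (hf : ∀ x, ‖convect (accel 1 U) (accel 1 U) x - gradient (fun y => 2⁻¹ * ‖gradient (pot 1 U) y‖ ^ 2) x‖ ≤ f)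
    (hsum : (Real.exp (ε / σ₀) - 1) * w + σ₀ * (Real.exp (ε / σ₀) - 1) * e +
      (σ₀ * (Real.exp (ε / σ₀) - 1)) ^ 2 * f ≤ c₄ * TowerRates.wide.Y 0) :
    ∀ t ∈ Icc (1 : ℝ) (1 + ε), ∀ x : EuclideanSpace ℝ (Fin 3),
      ‖germResid 1 U αhost (βhost σ₀) t x‖ ≤ c₄ * TowerRates.wide.Y 0 := by
  intro t ht x
  have ht' : 1 / 2 < t := by linarith [ht.1]
  obtain ⟨hq0, hq1⟩ := exp_sub_one_mem hσ₀ ht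
  obtain ⟨hs0, hs1⟩ := σline_mem hσ₀ ht
  have hQ0 : 0 ≤ Real.exp (ε / σ₀) - 1 := hq0.trans hq1
  have hS0 : 0 ≤ σ₀ * (Real.exp (ε / σ₀) - 1) := mul_nonneg hσ₀.le hQ0
  rw [germResid_line_eq hU hUc hσ₀.ne' ht' x]
  have h1 : ‖(Real.exp ((t - 1) / σ₀) - 1) • drift 1 U x‖ ≤ (Real.exp (ε / σ₀) - 1) * w := by
    rw [norm_smul, Real.norm_eq_abs, abs_of_nonneg hq0]
    exact mul_le_mul hq1 (hw x) (norm_nonneg _) hQ0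
  have h2 : ‖σline σ₀ t • (fderiv ℝ U x (accel 1 U x) + fderiv ℝ (accel 1 U) x (U x) - (Δ (accel 1 U)) x)‖ ≤
      σ₀ * (Real.exp (ε / σ₀) - 1) * e := by
    rw [norm_smul, Real.norm_eq_abs, abs_of_nonneg hs0]
    exact mul_le_mul hs1 (he x) (norm_nonneg _) hS0
  have h3 : ‖σline σ₀ t ^ 2 • (convect (accel 1 U) (accel 1 U) x -
      gradient (fun y => 2⁻¹ * ‖gradient (pot 1 U) y‖ ^ 2) x)‖ ≤ (σ₀ * (Real.exp (ε / σ₀) - 1)) ^ 2 * f := by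
    rw [norm_smul, Real.norm_eq_abs, abs_of_nonneg (sq_nonneg _)]
    exact mul_le_mul (pow_le_pow_left₀ hs0 hs1 2) (hf x) (norm_nonneg _) (sq_nonneg _)
  exact norm_add₃_le.trans (by linarith [h1, h2, h3, hsum])

end Window

/-! ## §4 The certificate constructor: `LineGermData` from a strict-slot filler and numeric data -/

section Constructor

variable {U : EuclideanSpace ℝ (Fin 3) → EuclideanSpace ℝ (Fin 3)} {ρ σ₀ ε c₄ : ℝ}

/-- **`LineGermData` FROM A STRICT-SLOT FILLER AND NUMERIC DATA** — the certificate's obligations, by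
name. Given `h : LevelZeroData U ρ` (readouts + strict test), numbers `σ₀ > 0`, `0 < ε ≤ w₀`, `0 < c₄ ≤ 1`, and
FOUR global sup inequalities — the endpoint inequality `‖U − σ₀V‖ ≤ Y₀` (`V = accel 1 U`) and the three
residual-field bounds `‖W‖ ≤ w`, `‖DU·V + DV·U − ΔV‖ ≤ e`, `‖(V·∇)V − ∇(|∇π|²/2)‖ ≤ f` with
`q w + σ₀ q e + (σ₀ q)² f ≤ c₄Y₀`, `q = e^{ε/σ₀} − 1` — the explicit slot `LineGermData U ρ σ₀ ε c₄` is filled.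
[cite: Palasek2026ElementaryModel, §3.3] -/
theorem LevelZeroData.lineGermData_of_bounds (h : LevelZeroData U ρ) (hσ₀ : 0 < σ₀)
    (hend : ∀ x, ‖U x - σ₀ • accel 1 U x‖ ≤ TowerRates.wide.Y 0)
    (hε : 0 < ε) (hεw : ε ≤ Host.wfirst) (hc₄ : 0 < c₄) (hc₄' : c₄ ≤ 1)
    {w e f : ℝ} (hw : ∀ x, ‖drift 1 U x‖ ≤ w)
    (he : ∀ x, ‖fderiv ℝ U x (accel 1 U x) + fderiv ℝ (accel 1 U) x (U x) - (Δ (accel 1 U)) x‖ ≤ e)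
    (hf : ∀ x, ‖convect (accel 1 U) (accel 1 U) x - gradient (fun y => 2⁻¹ * ‖gradient (pot 1 U) y‖ ^ 2) x‖ ≤ f)
    (hsum : (Real.exp (ε / σ₀) - 1) * w + σ₀ * (Real.exp (ε / σ₀) - 1) * e +
      (σ₀ * (Real.exp (ε / σ₀) - 1)) ^ 2 * f ≤ c₄ * TowerRates.wide.Y 0) :
    LineGermData U ρ σ₀ ε c₄ where
  smooth := h.smooth
  support := h.support
  divFree := h.divFree
  ceiling := h.ceiling
  floor := h.floor
  strain := h.strain
  core := h.core
  width_pos := hσ₀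
  line := fun _ hσl hσu x => line_anchor_of_endpoint h.ceiling h.anchor hσ₀ hend hσl hσu x
  fade_pos := hε
  fade_le := hεw
  push_pos := hc₄
  push_le := hc₄'
  window := window_of_field_bounds h.smooth h.hasCompactSupport hσ₀ hw he hf hsum

/-- **The same with the sup-bound form of the line anchor** (`‖V‖ ≤ M`, cap `{‖U‖ ≥ Y₀ − δ}` with
`⟪U, V⟫ ≥ κ`, `σ₀M² < 2κ`, `σ₀M ≤ δ`) — no strict test needed, so it applies to ANY profile with the readouts
(here taken from a `LevelZeroData` certificate for brevity). [cite: Palasek2026ElementaryModel, §3.3] -/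
theorem LevelZeroData.lineGermData_of_sup_bounds (h : LevelZeroData U ρ) (hσ₀ : 0 < σ₀) {M δ κ : ℝ}
    (hM : ∀ x, ‖accel 1 U x‖ ≤ M)
    (hcap : ∀ x, TowerRates.wide.Y 0 - δ ≤ ‖U x‖ → κ ≤ ⟪U x, accel 1 U x⟫)
    (hσ₁ : σ₀ * M ^ 2 < 2 * κ) (hσ₂ : σ₀ * M ≤ δ)
    (hε : 0 < ε) (hεw : ε ≤ Host.wfirst) (hc₄ : 0 < c₄) (hc₄' : c₄ ≤ 1)
    {w e f : ℝ} (hw : ∀ x, ‖drift 1 U x‖ ≤ w)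
    (he : ∀ x, ‖fderiv ℝ U x (accel 1 U x) + fderiv ℝ (accel 1 U) x (U x) - (Δ (accel 1 U)) x‖ ≤ e)
    (hf : ∀ x, ‖convect (accel 1 U) (accel 1 U) x - gradient (fun y => 2⁻¹ * ‖gradient (pot 1 U) y‖ ^ 2) x‖ ≤ f)
    (hsum : (Real.exp (ε / σ₀) - 1) * w + σ₀ * (Real.exp (ε / σ₀) - 1) * e +
      (σ₀ * (Real.exp (ε / σ₀) - 1)) ^ 2 * f ≤ c₄ * TowerRates.wide.Y 0) :
    LineGermData U ρ σ₀ ε c₄ where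
  smooth := h.smooth
  support := h.support
  divFree := h.divFree
  ceiling := h.ceiling
  floor := h.floor
  strain := h.strain
  core := h.core
  width_pos := hσ₀
  line := fun _ hσl hσu x => line_anchor_of_bounds h.ceiling hM hcap hσ₁ hσ₂ hσl hσu x
  fade_pos := hε
  fade_le := hεw
  push_pos := hc₄
  push_le := hc₄'
  window := window_of_field_bounds h.smooth h.hasCompactSupport hσ₀ hw he hf hsum

end Constructor

end Summit.NavierStokesRegularity.FluidComputer.PalasekTowerClayBridge.Germ

end
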